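import Mathlib
import HarnessLib
import Summits.NavierStokesRegularity.NavierStokesRegularity.Theorems.UnthreadedRigidityDoorUnthreadedRigidityVirialHornAngularJets
import Summits.NavierStokesRegularity.NavierStokesRegularity.Theorems.UnthreadedRigidityDoorUnthreadedRigidityVirialHornAngularFrame

/-!
# Route `UnthreadedRigidityDoor`, wall item W2 `UnthreadedRigidity` (stmt-NavierStokesRegularity-27585) — LINE g13-2 «EDGE COERCIVITY»
# (ns-idea-6 g13, `EdgeCoercive_sketch.lean` v1.3; DIRECTOR-NS #303 (A)): JETS OF `|∇Y|²` for the bracket–Laplacian identity (I9)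

Seat ns-es-p1 g9.  Third-order bookkeeping for the identity (I9) `Δ₃{Y,|∇Y|²} = 4{Y,|∇²Y|²}` (`BracketLaplacian l`, `…SpectralEdgeBracketLaplacian`):
with `g = ∇Y`, `H = D(∇Y)`, `T = D²(∇Y)` (tree jets `…VirialHornAngularJets`) and `N = |∇Y|²`,

* §1 generic `C²/C³` scalar functions: `dir2 θ v x = ⟪D(∇θ) v, v⟫`, `Δ₃θ = Σᵢ⟪D(∇θ) eᵢ, eᵢ⟫`, and the derivative of the Laplacian
  `D_u(Δ₃θ) = ⟪Σᵢ D²(∇θ) eᵢ eᵢ, u⟫` (`inner_sum_third_eq_fderiv_lap3`);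
* §2 the jets of `N`: `∇N = 2Hg` (tree), `D(∇N) v = 2(H(Hv) + T v g)`, `Δ₃N = 2|H|²` (Bochner, via `trace_third`), the derivative of `|H|² = Σᵢ‖Heᵢ‖²`,
  and `Σᵢ D²(∇N) eᵢ eᵢ = 2∇|H|²`;
* §3 the three antisymmetrisations that vanish for symmetric operators: `Σᵢ eᵢ × Heᵢ = 0`, `Σᵢ T eᵢ eᵢ = 0`, `Σᵢ⟪eᵢ × a, M eᵢ⟫ = 0`,
  `Σᵢ⟪y × Meᵢ, M(Meᵢ)⟫ = 0`.

HONEST LABEL: calculus helpers for a support of a files-only RUNG line two levels below W2; nothing here bears on `UnthreadedRigidity` (27585), W2 or NS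
regularity.  0 kit.  [folklore]
-/

noncomputable section

-- the summit and its single sub-problem share the name (CONVENTIONS §1), as in every Theorems file
set_option linter.dupNamespace false

namespace Summit.NavierStokesRegularity.NavierStokesRegularity.Theorems.UnthreadedRigidity.SpectralEdge

open Set Function Filter Topology
open scoped RealInnerProductSpace ContDiff
open Literature.Analysis.FluidPDE (cross)
open Summit.NavierStokesRegularity.NavierStokesRegularity.Theorems.UnthreadedRigidity.ProfileHorn (E3)
open Summit.NavierStokesRegularity.NavierStokesRegularity.Theorems.UnthreadedRigidity.VirialHorn

/-! ## §1 Generic: the Laplacian as a trace and its derivative -/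

section Generic

variable {θ : E3 → ℝ}

/-- `dir2 θ v x = ⟪D(∇θ)(x) v, v⟫` for a `C²` function. [folklore] -/
theorem dir2_eq_inner (hθ : ContDiff ℝ 2 θ) (v x : E3) : dir2 θ v x = ⟪fderiv ℝ (gradient θ) x v, v⟫ := by
  have hd : DifferentiableAt ℝ (fderiv ℝ θ) x := ((hθ.fderiv_right (m := 1) le_rfl).differentiable one_ne_zero) x
  unfold dir2
  rw [inner_fderiv_gradient hθ, fderiv_clm_apply hd (differentiableAt_const v)]
  simp only [fderiv_fun_const, Pi.zero_apply, ContinuousLinearMap.comp_zero, zero_add, ContinuousLinearMap.flip_apply]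

/-- `Δ₃θ(x) = Σᵢ ⟪D(∇θ)(x) eᵢ, eᵢ⟫` for a `C²` function. [folklore] -/
theorem lap3_eq_sum_inner (hθ : ContDiff ℝ 2 θ) (x : E3) : lap3 θ x = ∑ i : Fin 3, ⟪fderiv ℝ (gradient θ) x (e i), e i⟫ := by
  unfold lap3
  simp only [dir2_eq_inner hθ]

/-- THE DERIVATIVE OF THE LAPLACIAN: `D_u(Δ₃θ)(x) = ⟪Σᵢ D²(∇θ)(x) eᵢ eᵢ, u⟫` for a `C³` function (symmetry of the third derivative). [folklore] -/
theorem inner_sum_third_eq_fderiv_lap3 (hθ : ContDiff ℝ 3 θ) (x u : E3) :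
    ⟪∑ i : Fin 3, fderiv ℝ (fderiv ℝ (gradient θ)) x (e i) (e i), u⟫ = fderiv ℝ (lap3 θ) x u := by
  have hθ2 : ContDiff ℝ 2 θ := hθ.of_le (by norm_cast)
  have hg : ContDiff ℝ 2 (gradient θ) := (InnerProductSpace.toDual ℝ E3).symm.contDiff.comp (hθ.fderiv_right (m := 2) le_rfl)
  have hd : DifferentiableAt ℝ (fderiv ℝ (gradient θ)) x := ((hg.fderiv_right (m := 1) le_rfl).differentiable one_ne_zero) x
  have hfun : lap3 θ = fun z : E3 => ∑ i : Fin 3, ⟪fderiv ℝ (gradient θ) z (e i), e i⟫ := funext fun z => lap3_eq_sum_inner hθ2 z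
  have hder : ∀ i : Fin 3, HasFDerivAt (fun z : E3 => ⟪fderiv ℝ (gradient θ) z (e i), e i⟫)
      ((innerSL ℝ (e i)).comp ((fderiv ℝ (fderiv ℝ (gradient θ)) x).flip (e i))) x := by
    intro i
    have h1 : HasFDerivAt (fun z => fderiv ℝ (gradient θ) z (e i)) ((fderiv ℝ (fderiv ℝ (gradient θ)) x).flip (e i)) x := by
      have := hd.hasFDerivAt.clm_apply (hasFDerivAt_const (e i) x)
      simpa using this
    have h2 := h1.inner (𝕜 := ℝ) (hasFDerivAt_const (e i) x)
    refine h2.congr_fderiv ?_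
    ext v
    simp only [ContinuousLinearMap.comp_apply, ContinuousLinearMap.prod_apply, fderivInnerCLM_apply,
      ContinuousLinearMap.flip_apply, innerSL_apply_apply, _root_.zero_apply, inner_zero_right, zero_add]
    exact real_inner_comm (e i) (fderiv ℝ (fderiv ℝ (gradient θ)) x v (e i))
  have hsum := HasFDerivAt.fun_sum fun i (_ : i ∈ (Finset.univ : Finset (Fin 3))) => hder i
  rw [hfun, hsum.fderiv]
  simp only [FunLike.coe_sum, Finset.sum_apply, ContinuousLinearMap.comp_apply, ContinuousLinearMap.flip_apply,
    innerSL_apply_apply, sum_inner]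
  refine Finset.sum_congr rfl fun i _ => ?_
  rw [inner_fderiv_fderiv_gradient_symm hθ x (e i) (e i) u, fderiv_fderiv_gradient_symm hθ x (e i) u,
    real_inner_comm]

end Generic

/-! ## §2 The jets of `N = |∇Y|²` -/

section SolidHarmonic

variable {l : ℕ} {Y : E3 → ℝ}

/-- `N = |∇Y|²` is smooth. [folklore] -/
theorem contDiff_gradSq (hY : IsSolidHarmonic l Y) : ContDiff ℝ ∞ (fun z : E3 => ‖gradient Y z‖ ^ 2) :=
  hY.contDiff_gradient.norm_sq ℝ

/-- `∇N = 2 D(∇Y) ∇Y` as functions. [folklore] -/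
theorem gradient_gradSq_eq (hY : IsSolidHarmonic l Y) :
    gradient (fun z : E3 => ‖gradient Y z‖ ^ 2) = fun z : E3 => (2 : ℝ) • fderiv ℝ (gradient Y) z (gradient Y z) :=
  funext fun z => hY.gradient_normSq z

/-- `D(∇N)(y) = 2·(D(∇Y)∘D(∇Y) + D²(∇Y)(·)∇Y)`. [folklore] -/
theorem hasFDerivAt_gradient_gradSq (hY : IsSolidHarmonic l Y) (y : E3) :
    HasFDerivAt (gradient (fun z : E3 => ‖gradient Y z‖ ^ 2))
      ((2 : ℝ) • ((fderiv ℝ (gradient Y) y).comp (fderiv ℝ (gradient Y) y)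
        + (fderiv ℝ (fderiv ℝ (gradient Y)) y).flip (gradient Y y))) y := by
  rw [gradient_gradSq_eq hY]
  exact (hY.hasFDerivAt_hessian_gradient y).const_smul (2 : ℝ)

/-- `D(∇N)(y) v = 2(H(Hv) + T v g)`. [folklore] -/
theorem fderiv_gradient_gradSq_apply (hY : IsSolidHarmonic l Y) (y v : E3) :
    fderiv ℝ (gradient (fun z : E3 => ‖gradient Y z‖ ^ 2)) y v =
      (2 : ℝ) • (fderiv ℝ (gradient Y) y (fderiv ℝ (gradient Y) y v) + fderiv ℝ (fderiv ℝ (gradient Y)) y v (gradient Y y)) := by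
  rw [(hasFDerivAt_gradient_gradSq hY y).fderiv]
  simp only [FunLike.coe_smul, Pi.smul_apply, _root_.add_apply, ContinuousLinearMap.comp_apply, ContinuousLinearMap.flip_apply]

/-- `Σᵢ T eᵢ eᵢ = 0` (`Δ∇Y = ∇ΔY = 0`: `trace_third` with the symmetries of the third derivative). [folklore] -/
theorem sum_third_self (hY : IsSolidHarmonic l Y) (y : E3) :
    ∑ i : Fin 3, fderiv ℝ (fderiv ℝ (gradient Y)) y (e i) (e i) = 0 := by
  refine ext_inner_right ℝ fun u => ?_
  rw [sum_inner, inner_zero_left]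
  have h : ∀ i : Fin 3, ⟪fderiv ℝ (fderiv ℝ (gradient Y)) y (e i) (e i), u⟫ = ⟪fderiv ℝ (fderiv ℝ (gradient Y)) y u (e i), e i⟫ := by
    intro i
    rw [hY.third_symm' y (e i) (e i) u, hY.third_symm y (e i) u]
  simp only [h]
  exact hY.trace_third y u

/-- BOCHNER FOR A SOLID HARMONIC: `Δ₃|∇Y|² = 2|∇²Y|² = 2Σᵢ‖D(∇Y) eᵢ‖²`. [folklore] -/
theorem lap3_gradSq (hY : IsSolidHarmonic l Y) (y : E3) :
    lap3 (fun z : E3 => ‖gradient Y z‖ ^ 2) y = 2 * ∑ i : Fin 3, ‖fderiv ℝ (gradient Y) y (e i)‖ ^ 2 := by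
  have hN2 : ContDiff ℝ 2 (fun z : E3 => ‖gradient Y z‖ ^ 2) := (contDiff_gradSq hY).of_le (by norm_cast)
  rw [lap3_eq_sum_inner hN2, Finset.mul_sum]
  have hterm : ∀ i : Fin 3, ⟪fderiv ℝ (gradient (fun z : E3 => ‖gradient Y z‖ ^ 2)) y (e i), e i⟫ =
      2 * ‖fderiv ℝ (gradient Y) y (e i)‖ ^ 2 + 2 * ⟪fderiv ℝ (fderiv ℝ (gradient Y)) y (gradient Y y) (e i), e i⟫ := by
    intro i
    rw [fderiv_gradient_gradSq_apply hY, inner_smul_left, inner_add_left, hY.hessian_symm y _ (e i),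
      real_inner_self_eq_norm_sq, hY.third_symm y (e i) (gradient Y y)]
    simp only [conj_trivial]
    ring
  simp only [hterm, Finset.sum_add_distrib, ← Finset.mul_sum, hY.trace_third y (gradient Y y), mul_zero, add_zero]

/-- THE DERIVATIVE OF `|∇²Y|² = Σᵢ‖D(∇Y) eᵢ‖²`: `D_w |∇²Y|² = 2Σᵢ⟪T w eᵢ, H eᵢ⟫`. [folklore] -/
theorem hasFDerivAt_hessSq (hY : IsSolidHarmonic l Y) (y : E3) :
    HasFDerivAt (fun z : E3 => ∑ i : Fin 3, ‖fderiv ℝ (gradient Y) z (e i)‖ ^ 2)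
      (∑ i : Fin 3, (2 : ℝ) • ((innerSL ℝ (fderiv ℝ (gradient Y) y (e i))).comp ((fderiv ℝ (fderiv ℝ (gradient Y)) y).flip (e i)))) y := by
  have hd : DifferentiableAt ℝ (fderiv ℝ (gradient Y)) y := (hY.contDiff_hessian.differentiable (by simp)) y
  refine HasFDerivAt.fun_sum fun i _ => ?_
  have h1 : HasFDerivAt (fun z => fderiv ℝ (gradient Y) z (e i)) ((fderiv ℝ (fderiv ℝ (gradient Y)) y).flip (e i)) y := by
    have := hd.hasFDerivAt.clm_apply (hasFDerivAt_const (e i) y)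
    simpa using this
  refine (h1.norm_sq).congr_fderiv ?_
  ext w
  simp only [two_smul]

/-- `D_w |∇²Y|² = 2Σᵢ⟪T w eᵢ, H eᵢ⟫`, `fderiv` form. [folklore] -/
theorem fderiv_hessSq_apply (hY : IsSolidHarmonic l Y) (y w : E3) :
    fderiv ℝ (fun z : E3 => ∑ i : Fin 3, ‖fderiv ℝ (gradient Y) z (e i)‖ ^ 2) y w =
      2 * ∑ i : Fin 3, ⟪fderiv ℝ (fderiv ℝ (gradient Y)) y w (e i), fderiv ℝ (gradient Y) y (e i)⟫ := by
  rw [(hasFDerivAt_hessSq hY y).fderiv, Finset.mul_sum]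
  simp only [FunLike.coe_sum, Finset.sum_apply, FunLike.coe_smul, Pi.smul_apply, ContinuousLinearMap.comp_apply,
    ContinuousLinearMap.flip_apply, innerSL_apply_apply, smul_eq_mul]
  refine Finset.sum_congr rfl fun i _ => ?_
  rw [real_inner_comm]

/-- `⟪∇|∇²Y|²(y), w⟫ = 2Σᵢ⟪T w eᵢ, H eᵢ⟫`. [folklore] -/
theorem inner_gradient_hessSq (hY : IsSolidHarmonic l Y) (y w : E3) :
    ⟪gradient (fun z : E3 => ∑ i : Fin 3, ‖fderiv ℝ (gradient Y) z (e i)‖ ^ 2) y, w⟫ =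
      2 * ∑ i : Fin 3, ⟪fderiv ℝ (fderiv ℝ (gradient Y)) y w (e i), fderiv ℝ (gradient Y) y (e i)⟫ := by
  rw [gradient, InnerProductSpace.toDual_symm_apply, fderiv_hessSq_apply hY]

/-- ★ `Σᵢ D²(∇N) eᵢ eᵢ = 2 ∇|∇²Y|²` (differentiate Bochner `Δ₃N = 2|∇²Y|²` and use the symmetry of `D³N`). [folklore] -/
theorem sum_third_gradSq (hY : IsSolidHarmonic l Y) (y : E3) :
    ∑ i : Fin 3, fderiv ℝ (fderiv ℝ (gradient (fun z : E3 => ‖gradient Y z‖ ^ 2))) y (e i) (e i) =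
      (2 : ℝ) • gradient (fun z : E3 => ∑ i : Fin 3, ‖fderiv ℝ (gradient Y) z (e i)‖ ^ 2) y := by
  have hN3 : ContDiff ℝ 3 (fun z : E3 => ‖gradient Y z‖ ^ 2) := (contDiff_gradSq hY).of_le (by norm_cast)
  refine ext_inner_right ℝ fun u => ?_
  rw [inner_sum_third_eq_fderiv_lap3 hN3, inner_smul_left, inner_gradient_hessSq hY]
  have hfun : lap3 (fun z : E3 => ‖gradient Y z‖ ^ 2) = fun z : E3 => 2 * ∑ i : Fin 3, ‖fderiv ℝ (gradient Y) z (e i)‖ ^ 2 :=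
    funext fun z => lap3_gradSq hY z
  rw [hfun, fderiv_const_mul (hasFDerivAt_hessSq hY y).differentiableAt]
  simp only [FunLike.coe_smul, Pi.smul_apply, smul_eq_mul, conj_trivial, fderiv_hessSq_apply hY]

/-! ## §3 Antisymmetrisations of symmetric operators vanish -/

/-- the inner product in coordinates (private copy). -/
private theorem real_inner_e3' (u v : E3) : ⟪u, v⟫ = u 0 * v 0 + u 1 * v 1 + u 2 * v 2 := by
  simp [PiLp.inner_apply, Fin.sum_univ_three, mul_comm]

/-- a component of the cross product (private copy). -/
private theorem cross_apply_zero' (u v : E3) : cross u v 0 = u 1 * v 2 - u 2 * v 1 := by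
  simp [cross, cross_apply]

/-- a component of the cross product (private copy). -/
private theorem cross_apply_one' (u v : E3) : cross u v 1 = u 2 * v 0 - u 0 * v 2 := by
  simp [cross, cross_apply]

/-- a component of the cross product (private copy). -/
private theorem cross_apply_two' (u v : E3) : cross u v 2 = u 0 * v 1 - u 1 * v 0 := by
  simp [cross, cross_apply]

/-- a coordinate of a basis vector (private copy). -/
private theorem e00 : e 0 0 = 1 := by simp [e]
/-- a coordinate of a basis vector (private copy). -/
private theorem e01 : e 0 1 = 0 := by simp [e]
/-- a coordinate of a basis vector (private copy). -/
private theorem e02 : e 0 2 = 0 := by simp [e]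
/-- a coordinate of a basis vector (private copy). -/
private theorem e10 : e 1 0 = 0 := by simp [e]
/-- a coordinate of a basis vector (private copy). -/
private theorem e11 : e 1 1 = 1 := by simp [e]
/-- a coordinate of a basis vector (private copy). -/
private theorem e12 : e 1 2 = 0 := by simp [e]
/-- a coordinate of a basis vector (private copy). -/
private theorem e20 : e 2 0 = 0 := by simp [e]
/-- a coordinate of a basis vector (private copy). -/
private theorem e21 : e 2 1 = 0 := by simp [e]
/-- a coordinate of a basis vector (private copy). -/
private theorem e22 : e 2 2 = 1 := by simp [e]

/-- a coordinate of a vector is its inner product with the basis vector. -/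
theorem apply_eq_inner_e (v : E3) (i : Fin 3) : v i = ⟪v, e i⟫ := by
  rw [e, EuclideanSpace.inner_single_right]; simp

/-- expansion of a vector in the standard basis. [folklore] -/
theorem eq_sum_smul_e (v : E3) : v = ∑ j : Fin 3, v j • e j := by
  ext k
  fin_cases k <;> simp [Fin.sum_univ_three, e]

/-- entries of a symmetric operator are symmetric. -/
theorem apply_e_symm (M : E3 →L[ℝ] E3) (hM : ∀ u w : E3, ⟪M u, w⟫ = ⟪u, M w⟫) (i j : Fin 3) : M (e i) j = M (e j) i := by
  rw [apply_eq_inner_e, apply_eq_inner_e, hM, real_inner_comm]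

/-- `Σᵢ ⟪eᵢ × M eᵢ, a⟫ = 0` for a symmetric operator `M` (the axial vector of the antisymmetric part vanishes). [folklore] -/
theorem sum_inner_cross_e_apply_left_eq_zero (M : E3 →L[ℝ] E3) (hM : ∀ u w : E3, ⟪M u, w⟫ = ⟪u, M w⟫) (a : E3) :
    ∑ i : Fin 3, ⟪cross (e i) (M (e i)), a⟫ = 0 := by
  have hs10 := apply_e_symm M hM 1 0
  have hs20 := apply_e_symm M hM 2 0
  have hs21 := apply_e_symm M hM 2 1
  simp only [Fin.sum_univ_three, real_inner_e3', cross_apply_zero', cross_apply_one', cross_apply_two',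
    e00, e01, e02, e10, e11, e12, e20, e21, e22]
  rw [hs10, hs20, hs21]
  ring

/-- `Σᵢ ⟪eᵢ × a, M eᵢ⟫ = 0` for a symmetric operator `M` and any `a`. [folklore] -/
theorem sum_inner_cross_e_apply_eq_zero (M : E3 →L[ℝ] E3) (hM : ∀ u w : E3, ⟪M u, w⟫ = ⟪u, M w⟫) (a : E3) :
    ∑ i : Fin 3, ⟪cross (e i) a, M (e i)⟫ = 0 := by
  have hs10 := apply_e_symm M hM 1 0
  have hs20 := apply_e_symm M hM 2 0
  have hs21 := apply_e_symm M hM 2 1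
  simp only [Fin.sum_univ_three, real_inner_e3', cross_apply_zero', cross_apply_one', cross_apply_two',
    e00, e01, e02, e10, e11, e12, e20, e21, e22]
  rw [hs10, hs20, hs21]
  ring

/-- `Σᵢ ⟪y × M eᵢ, M(M eᵢ)⟫ = 0` for a symmetric operator `M` (`M·M²` is symmetric). [folklore] -/
theorem sum_inner_cross_apply_sq_eq_zero (M : E3 →L[ℝ] E3) (hM : ∀ u w : E3, ⟪M u, w⟫ = ⟪u, M w⟫) (y : E3) :
    ∑ i : Fin 3, ⟪cross y (M (e i)), M (M (e i))⟫ = 0 := by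
  have hs10 := apply_e_symm M hM 1 0
  have hs20 := apply_e_symm M hM 2 0
  have hs21 := apply_e_symm M hM 2 1
  have hMM : ∀ i : Fin 3, M (M (e i)) = ∑ j : Fin 3, M (e i) j • M (e j) := by
    intro i
    conv_lhs => rw [eq_sum_smul_e (M (e i))]
    rw [map_sum]
    simp only [map_smul]
  simp only [hMM, Fin.sum_univ_three, real_inner_e3', cross_apply_zero', cross_apply_one', cross_apply_two', PiLp.add_apply,
    PiLp.smul_apply, smul_eq_mul]
  rw [hs10, hs20, hs21]
  ring

end SolidHarmonic

end Summit.NavierStokesRegularity.NavierStokesRegularity.Theorems.UnthreadedRigidity.SpectralEdge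

end
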